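import Mathlib.Analysis.Fourier.FourierTransform
import Literature.NumberTheory.LFunctions.MontgomeryExplicitFormulaProofs
import Literature.NumberTheory.LFunctions.RudnickSarnakZeros
import HarnessLib

/-!
# Montgomery's theorem against a test function: smoothed pair sums of the zeros of `ζ`

Proofs only (no definitions, no named facts). Second instalment towards the named fact
`Literature.NumberTheory.LFunctions.rudnick_sarnak_unrestricted` (Z. Rudnick, P. Sarnak, *Zeros
of principal `L`-functions and random matrix theory*, Duke Math. J. **81** (1996), Theorem 3.2
for `m = 1`) at level `n = 2`, where — as Rudnick–Sarnak remark after their Theorem 1.2 — the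
statement "coincides with the result of Montgomery". The tree PROVES Montgomery's theorem
(`montgomery_pair_correlation_restricted_holds`, H. L. Montgomery, *The pair correlation of zeros
of the zeta function*, Proc. Sympos. Pure Math. 24 (1973), Theorem, uniform clause) in the
form-factor normalisation `F(α, T) = (2π/(T log T)) ∑_{0<γ,γ'≤T} T^{iα(γ−γ')} w(γ − γ')`,
`w(u) = 4/(4 + u²)`. This file integrates it against a test function `ψ` supported inside
`(−1, 1)` (D. A. Goldston, *Notes on pair correlation of zeros and prime numbers* (2005), §5,
(5.3)–(5.5): "on multiplying (4.9) by `r̂(α)` and integrating"):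

* `RudnickSarnak.sum_pairs_fourier_eq_integral_formFactor` — the duality
  `∑_{0<γ,γ'≤T} w(γ − γ') ψ̂(L(γ − γ')/2π) = (T L/2π) ∫ F(α, T) ψ(α) dα` (`L = log T`,
  `ψ̂ = 𝓕 ψ` Mathlib's Fourier transform, zeros with multiplicity), for continuous compactly
  supported `ψ` and `T > 1`;
* `RudnickSarnak.tendsto_integral_log_mul_rpow_mul` — the kernel `log T · T^{−2|α|}` has mass
  one and is an approximate identity (the Dirac term of Montgomery's theorem);
* `RudnickSarnak.norm_integral_formFactor_sub_le`, `RudnickSarnak.norm_integral_formFactor_le` —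
  Montgomery's uniform estimate integrated against `θ` (deterministic in the estimate, hence
  uniform in phases of `θ`);
* `RudnickSarnak.tendsto_integral_formFactor_mul` — under RH,
  `∫ F(α, T) ψ(α) dα → ψ(0) + ∫ |α| ψ(α) dα`;
* `RudnickSarnak.tendsto_zetaZeroCount_div_main` — `N(T)/((T/2π) log T) → 1`
  (Riemann–von Mangoldt, `riemann_von_mangoldt_holds`);
* `RudnickSarnak.tendsto_sum_pairs_weight_fourier_div` — under RH,
  `(1/N(T)) ∑_{0<γ,γ'≤T} w(γ − γ') ψ̂(L(γ − γ')/2π) → ψ(0) + ∫ |α| ψ(α) dα`, which is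
  Rudnick–Sarnak's `∫ Φ C_O = Φ(0) + ∫ |v| Φ(v e_{12}) dv` ((3.9) at `n = 2`) for
  `ψ(α) = Φ(α, −α)`, still in Montgomery's normalisation `L(γ − γ')/2π` and with his weight `w`
  (their removal, RS (3.71)–(3.77), is the next instalment).

## References

* H. L. Montgomery, Proc. Sympos. Pure Math. 24 (1973), 181–193: Theorem, (1).
* D. A. Goldston, *Notes on pair correlation of zeros and prime numbers*, in: Recent
  Perspectives in Random Matrix Theory and Number Theory, LMS LNS 322 (2005), §5, (5.1)–(5.5).
* Z. Rudnick, P. Sarnak, Duke Math. J. 81 (1996): Thm. 1.2 and the Remark following it; (3.9).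
* E. C. Titchmarsh, *The Theory of the Riemann Zeta-Function* (1986), Thm. 9.4.
-/

noncomputable section

open Filter MeasureTheory Complex Finset Set
open scoped Real Topology FourierTransform

namespace Literature.NumberTheory.LFunctions

namespace RudnickSarnak

/-- `∫ cos(αc) ψ(α) dα = (ψ̂(c/2π) + ψ̂(−c/2π))/2` for continuous compactly supported `ψ`,
`ψ̂ = 𝓕 ψ` Mathlib's Fourier transform (`𝓕 ψ (w) = ∫ e^{−2πivw} ψ(v) dv`). [folklore] -/
theorem integral_cos_mul_eq_fourier (ψ : ℝ → ℂ) (hψ : Continuous ψ) (hsupp : HasCompactSupport ψ)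
    (c : ℝ) :
    ∫ α : ℝ, (Real.cos (α * c) : ℂ) * ψ α =
      (𝓕 ψ (c / (2 * π)) + 𝓕 ψ (-(c / (2 * π)))) / 2 := by
  rw [Real.fourier_real_eq_integral_exp_smul, Real.fourier_real_eq_integral_exp_smul]
  have e1 : ∀ v : ℝ, cexp (↑(-2 * π * v * (c / (2 * π))) * I) = cexp (-(v * c : ℝ) * I) := by
    intro v
    congr 2
    push_cast
    field_simp
  have e2 : ∀ v : ℝ, cexp (↑(-2 * π * v * -(c / (2 * π))) * I) = cexp ((v * c : ℝ) * I) := by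
    intro v
    congr 2
    push_cast
    field_simp
  simp_rw [e1, e2, smul_eq_mul]
  have hi1 : Integrable fun v : ℝ ↦ cexp (-(v * c : ℝ) * I) * ψ v :=
    ((by fun_prop : Continuous fun v : ℝ ↦ cexp (-(v * c : ℝ) * I) * ψ v).integrable_of_hasCompactSupport
      hsupp.mul_left)
  have hi2 : Integrable fun v : ℝ ↦ cexp ((v * c : ℝ) * I) * ψ v :=
    ((by fun_prop : Continuous fun v : ℝ ↦ cexp ((v * c : ℝ) * I) * ψ v).integrable_of_hasCompactSupport
      hsupp.mul_left)
  rw [← integral_add hi1 hi2, eq_div_iff two_ne_zero, mul_comm, ← smul_eq_mul, ← integral_smul]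
  refine integral_congr_ae (Eventually.of_forall fun v ↦ ?_)
  simp only [smul_eq_mul]
  rw [← add_mul, ← mul_assoc]
  congr 1
  rw [ofReal_cos, Complex.two_cos]
  push_cast
  ring_nf

/-- Montgomery's weight is even. [cite: Montgomery1973, §1 (1)] -/
theorem montgomeryWeight_neg (u : ℝ) : montgomeryWeight (-u) = montgomeryWeight u := by
  simp [montgomeryWeight]

/-- Symmetrisation over ordered pairs: `∑_{p ∈ s × s} w(u_p) G(−y_p) = ∑_{p ∈ s × s} w(u_p) G(y_p)`
for the antisymmetric quantities `u_p = γ_{p₁} − γ_{p₂}`, `y_p = c · u_p` (swap `p ↦ p.swap`).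
[folklore] -/
theorem sum_pairs_swap (s : Finset ℕ) (γ : ℕ → ℝ) (G : ℝ → ℂ) (c : ℝ) :
    ∑ p ∈ s ×ˢ s, (montgomeryWeight (γ p.1 - γ p.2) : ℂ) * G (-(c * (γ p.1 - γ p.2))) =
      ∑ p ∈ s ×ˢ s, (montgomeryWeight (γ p.1 - γ p.2) : ℂ) * G (c * (γ p.1 - γ p.2)) := by
  refine Finset.sum_equiv (Equiv.prodComm ℕ ℕ) (fun p ↦ ?_) (fun p hp ↦ ?_)
  · simp only [Finset.mem_product, Equiv.prodComm_apply, Prod.fst_swap, Prod.snd_swap]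
    exact and_comm
  · simp only [Equiv.prodComm_apply, Prod.fst_swap, Prod.snd_swap]
    rw [← montgomeryWeight_neg]
    congr 2 <;> ring

/-- **Smoothed pair sums against Montgomery's form factor** (Goldston 2005, §5, (5.3):
`∑_{0<γ,γ'≤T} r((γ − γ') log T/2π) w(γ − γ') = (T/2π) log T ∫ r̂(α) F(α) dα`; here with
`r = ψ̂`): for continuous compactly supported `ψ` with Fourier transform `ψ̂ = 𝓕 ψ` and
`T > 1`, `L = log T`,
`∑_{0 < γ, γ' ≤ T} w(γ − γ') ψ̂(L(γ − γ')/2π) = (T L / 2π) ∫ F(α, T) ψ(α) dα`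
(zeros with multiplicity, `F = montgomeryFormFactor`): expand `F`, exchange the finite sum and
the integral, `∫ cos(αLu) ψ(α) dα = (ψ̂(Lu/2π) + ψ̂(−Lu/2π))/2`, and symmetrise over
`(γ, γ') ↔ (γ', γ)`. [cite: Goldston2005, §5 (5.3)] -/
theorem sum_pairs_fourier_eq_integral_formFactor (ψ : ℝ → ℂ) (hψ : Continuous ψ)
    (hsupp : HasCompactSupport ψ) {T : ℝ} (hT : 1 < T) :
    ∑ p ∈ zeroIndexSet T ×ˢ zeroIndexSet T,
        (montgomeryWeight (zetaOrdinate p.1 - zetaOrdinate p.2) : ℂ) *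
          𝓕 ψ (Real.log T / (2 * π) * (zetaOrdinate p.1 - zetaOrdinate p.2)) =
      (T * Real.log T / (2 * π) : ℝ) * ∫ α : ℝ, (montgomeryFormFactor α T : ℂ) * ψ α := by
  have hL : 0 < Real.log T := Real.log_pos hT
  have hT0 : 0 < T := one_pos.trans hT
  -- each term `w(u) cos(α L u) ψ(α)` is integrable
  have hint : ∀ p ∈ zeroIndexSet T ×ˢ zeroIndexSet T, Integrable fun α : ℝ ↦
      (montgomeryWeight (zetaOrdinate p.1 - zetaOrdinate p.2) : ℂ) *
        ((Real.cos (α * (Real.log T * (zetaOrdinate p.1 - zetaOrdinate p.2))) : ℂ) * ψ α) := by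
    intro p _
    refine Integrable.const_mul ?_ _
    exact (by fun_prop : Continuous fun α : ℝ ↦
      ((Real.cos (α * (Real.log T * (zetaOrdinate p.1 - zetaOrdinate p.2))) : ℂ) *
        ψ α)).integrable_of_hasCompactSupport hsupp.mul_left
  -- expand `F` inside the integral
  have hF : ∀ α : ℝ, (montgomeryFormFactor α T : ℂ) * ψ α =
      (2 * π / (T * Real.log T) : ℝ) * ∑ p ∈ zeroIndexSet T ×ˢ zeroIndexSet T,
        (montgomeryWeight (zetaOrdinate p.1 - zetaOrdinate p.2) : ℂ) *
          ((Real.cos (α * (Real.log T * (zetaOrdinate p.1 - zetaOrdinate p.2))) : ℂ) * ψ α) := by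
    intro α
    have h1 : montgomeryFormFactor α T = 2 * π / (T * Real.log T) *
        ∑ p ∈ zeroIndexSet T ×ˢ zeroIndexSet T,
          Real.cos (α * (Real.log T * (zetaOrdinate p.1 - zetaOrdinate p.2))) *
            montgomeryWeight (zetaOrdinate p.1 - zetaOrdinate p.2) := by
      simp only [montgomeryFormFactor, mul_assoc]
    rw [h1]
    push_cast
    rw [Finset.mul_sum, Finset.mul_sum, Finset.sum_mul]
    refine Finset.sum_congr rfl fun p _ ↦ ?_
    ring
  simp_rw [hF]
  rw [integral_const_mul, integral_finsetSum _ hint]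
  simp_rw [integral_const_mul, integral_cos_mul_eq_fourier ψ hψ hsupp]
  -- symmetrise
  have e3 : ∀ u : ℝ, Real.log T * u / (2 * π) = Real.log T / (2 * π) * u := fun u ↦ by ring
  simp_rw [e3]
  have hsym := sum_pairs_swap (zeroIndexSet T) zetaOrdinate (𝓕 ψ) (Real.log T / (2 * π))
  have h2 : ∑ p ∈ zeroIndexSet T ×ˢ zeroIndexSet T,
      (montgomeryWeight (zetaOrdinate p.1 - zetaOrdinate p.2) : ℂ) *
        ((𝓕 ψ (Real.log T / (2 * π) * (zetaOrdinate p.1 - zetaOrdinate p.2)) +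
          𝓕 ψ (-(Real.log T / (2 * π) * (zetaOrdinate p.1 - zetaOrdinate p.2)))) / 2) =
      (∑ p ∈ zeroIndexSet T ×ˢ zeroIndexSet T,
          (montgomeryWeight (zetaOrdinate p.1 - zetaOrdinate p.2) : ℂ) *
            𝓕 ψ (Real.log T / (2 * π) * (zetaOrdinate p.1 - zetaOrdinate p.2)) +
        ∑ p ∈ zeroIndexSet T ×ˢ zeroIndexSet T,
          (montgomeryWeight (zetaOrdinate p.1 - zetaOrdinate p.2) : ℂ) *
            𝓕 ψ (-(Real.log T / (2 * π) * (zetaOrdinate p.1 - zetaOrdinate p.2)))) / 2 := by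
    rw [← Finset.sum_add_distrib, Finset.sum_div]
    refine Finset.sum_congr rfl fun p _ ↦ ?_
    ring
  rw [h2, hsym, ← mul_assoc]
  have hc : ((T * Real.log T / (2 * π) : ℝ) : ℂ) * ((2 * π / (T * Real.log T) : ℝ) : ℂ) = 1 := by
    rw [← ofReal_mul]
    have : T * Real.log T / (2 * π) * (2 * π / (T * Real.log T)) = 1 := by
      field_simp
    rw [this, ofReal_one]
  rw [hc, one_mul]
  ring

/-! ## The kernel `L T^{-2|α|}`: an approximate identity -/

/-- `∫ e^{-c|α|} dα = 2/c` for `c > 0`. [folklore] -/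
theorem integral_exp_neg_mul_abs {c : ℝ} (hc : 0 < c) :
    ∫ α : ℝ, Real.exp (-c * |α|) = 2 / c := by
  have h := integral_comp_abs (f := fun x : ℝ ↦ Real.exp (-c * x))
  rw [h, integral_exp_mul_Ioi (neg_lt_zero.2 hc) 0]
  simp only [mul_zero, Real.exp_zero]
  field_simp

/-- `α ↦ e^{-c|α|}` is integrable for `c > 0`. [folklore] -/
theorem integrable_exp_neg_mul_abs {c : ℝ} (hc : 0 < c) :
    Integrable fun α : ℝ ↦ Real.exp (-c * |α|) := by
  have h1 : IntegrableOn (fun α : ℝ ↦ Real.exp (-c * |α|)) (Ioi 0) := by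
    refine (integrableOn_exp_mul_Ioi (neg_lt_zero.2 hc) 0).congr_fun (fun α hα ↦ ?_)
      measurableSet_Ioi
    rw [abs_of_pos hα]
  have h2 : IntegrableOn (fun α : ℝ ↦ Real.exp (-c * |α|)) (Iic 0) := by
    refine (integrableOn_exp_mul_Iic hc 0).congr_fun (fun α hα ↦ ?_) measurableSet_Iic
    rw [abs_of_nonpos hα]
    ring_nf
  have := integrableOn_union.2 ⟨h2, h1⟩
  rwa [Iic_union_Ioi, integrableOn_univ] at this

/-- For `T > 0`: `T^{-2|α|} = e^{-2 log T · |α|}`. [folklore] -/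
theorem rpow_neg_two_mul_abs {T : ℝ} (hT : 0 < T) (α : ℝ) :
    T ^ (-2 * |α|) = Real.exp (-(2 * Real.log T) * |α|) := by
  rw [Real.rpow_def_of_pos hT]
  congr 1
  ring

/-- The kernel `α ↦ log T · T^{-2|α|}` is integrable (`T > 1`). [folklore] -/
theorem integrable_log_mul_rpow {T : ℝ} (hT : 1 < T) :
    Integrable fun α : ℝ ↦ Real.log T * T ^ (-2 * |α|) := by
  have hL : 0 < Real.log T := Real.log_pos hT
  simp_rw [rpow_neg_two_mul_abs (one_pos.trans hT)]
  exact (integrable_exp_neg_mul_abs (by positivity)).const_mul _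

/-- The kernel `log T · T^{-2|α|}` has total mass `1` (`T > 1`). [folklore] -/
theorem integral_log_mul_rpow {T : ℝ} (hT : 1 < T) :
    ∫ α : ℝ, Real.log T * T ^ (-2 * |α|) = 1 := by
  have hL : 0 < Real.log T := Real.log_pos hT
  simp_rw [rpow_neg_two_mul_abs (one_pos.trans hT)]
  rw [integral_const_mul, integral_exp_neg_mul_abs (by positivity)]
  field_simp

/-- **Approximate identity.** For a continuous bounded `θ : ℝ → ℂ`,
`∫ log T · T^{-2|α|} θ(α) dα → θ(0)` as `T → ∞`: the kernel has mass `1` and concentrates at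
`0` (`log T · T^{-2|α|} ≤ log T · T^{-η} T^{-|α|}` for `|α| ≥ η`). This is the source of the
Dirac term in Montgomery's `F(α) = (1 + o(1)) T^{-2|α|} log T + |α| + o(1)`.
[cite: Montgomery1973, §1 Theorem] -/
theorem tendsto_integral_log_mul_rpow_mul {θ : ℝ → ℂ} (hθ : Continuous θ) {B : ℝ}
    (hB : ∀ α, ‖θ α‖ ≤ B) :
    Tendsto (fun T : ℝ ↦ ∫ α : ℝ, ((Real.log T * T ^ (-2 * |α|) : ℝ) : ℂ) * θ α) atTop
      (𝓝 (θ 0)) := by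
  have hB0 : 0 ≤ B := (norm_nonneg _).trans (hB 0)
  refine Metric.tendsto_nhds.2 fun ε hε ↦ ?_
  -- continuity at `0`
  obtain ⟨η, hη, hcont⟩ : ∃ η > 0, ∀ α : ℝ, |α| < η → ‖θ α - θ 0‖ < ε / 2 := by
    obtain ⟨η, hη, h⟩ := Metric.continuous_iff.1 hθ 0 (ε / 2) (by positivity)
    exact ⟨η, hη, fun α hα ↦ by simpa [dist_eq_norm] using h α (by simpa [dist_eq_norm] using hα)⟩
  -- `4 B T^{-η} < ε / 2` eventually
  have hsmall : ∀ᶠ T : ℝ in atTop, 4 * B * T ^ (-η) < ε / 2 := by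
    have h0 : Tendsto (fun T : ℝ ↦ 4 * B * T ^ (-η)) atTop (𝓝 (4 * B * 0)) :=
      (tendsto_rpow_neg_atTop hη).const_mul _
    rw [mul_zero] at h0
    exact h0.eventually (gt_mem_nhds (by positivity))
  filter_upwards [hsmall, eventually_gt_atTop (1 : ℝ)] with T hT4 hT
  have hT0 : 0 < T := one_pos.trans hT
  have hL : 0 < Real.log T := Real.log_pos hT
  set K : ℝ → ℝ := fun α ↦ Real.log T * T ^ (-2 * |α|) with hK
  have hKnn : ∀ α, 0 ≤ K α := fun α ↦ by positivity
  have hKi : Integrable K := integrable_log_mul_rpow hT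
  have hK1 : ∫ α, K α = 1 := integral_log_mul_rpow hT
  -- rewrite the difference as `∫ K (θ − θ 0)`
  have hθi : Integrable fun α : ℝ ↦ ((K α : ℝ) : ℂ) * θ α :=
    hKi.ofReal.mul_bdd hθ.aestronglyMeasurable (Eventually.of_forall hB)
  have hθc : Integrable fun α : ℝ ↦ ((K α : ℝ) : ℂ) * θ 0 := hKi.ofReal.mul_const _
  have hdiff : (∫ α, ((K α : ℝ) : ℂ) * θ α) - θ 0 = ∫ α, ((K α : ℝ) : ℂ) * (θ α - θ 0) := by
    have h1 : ∫ α, ((K α : ℝ) : ℂ) * θ 0 = θ 0 := by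
      rw [integral_mul_const, integral_complex_ofReal, hK1]
      simp
    simp_rw [mul_sub]
    rw [integral_sub hθi hθc, h1]
  change dist (∫ α, ((K α : ℝ) : ℂ) * θ α) (θ 0) < ε
  rw [dist_eq_norm, hdiff]
  -- pointwise bound
  set G : ℝ → ℝ := fun α ↦ ε / 2 * K α +
    2 * B * (Real.log T * T ^ (-η)) * Real.exp (-Real.log T * |α|) with hG
  have hGi : Integrable G :=
    (hKi.const_mul _).add ((integrable_exp_neg_mul_abs hL).const_mul _)
  have hGint : ∫ α, G α = ε / 2 + 4 * B * T ^ (-η) := by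
    have i1 : ∫ α, ε / 2 * K α = ε / 2 := by rw [integral_const_mul, hK1, mul_one]
    have i2 : ∫ α, 2 * B * (Real.log T * T ^ (-η)) * Real.exp (-Real.log T * |α|) =
        2 * B * (Real.log T * T ^ (-η)) * (2 / Real.log T) := by
      rw [integral_const_mul, integral_exp_neg_mul_abs hL]
    rw [hG, integral_add (hKi.const_mul _) ((integrable_exp_neg_mul_abs hL).const_mul _), i1, i2]
    field_simp
    ring
  have hbound : ∀ α, ‖((K α : ℝ) : ℂ) * (θ α - θ 0)‖ ≤ G α := by
    intro α
    rw [norm_mul, Complex.norm_real, Real.norm_of_nonneg (hKnn α)]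
    have hterm2 : 0 ≤ 2 * B * (Real.log T * T ^ (-η)) * Real.exp (-Real.log T * |α|) := by
      positivity
    rcases lt_or_ge |α| η with hα | hα
    · have h := (hcont α hα).le
      calc K α * ‖θ α - θ 0‖ ≤ K α * (ε / 2) := mul_le_mul_of_nonneg_left h (hKnn α)
        _ = ε / 2 * K α := by ring
        _ ≤ G α := le_add_of_nonneg_right hterm2
    · have h2B : ‖θ α - θ 0‖ ≤ 2 * B :=
        (norm_sub_le _ _).trans (by linarith [hB α, hB 0])
      have hKle : K α ≤ Real.log T * T ^ (-η) * Real.exp (-Real.log T * |α|) := by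
        simp only [hK]
        rw [mul_assoc]
        refine mul_le_mul_of_nonneg_left ?_ hL.le
        rw [Real.rpow_def_of_pos hT0, Real.rpow_def_of_pos hT0, ← Real.exp_add]
        exact Real.exp_le_exp.2 (by nlinarith)
      calc K α * ‖θ α - θ 0‖
          ≤ (Real.log T * T ^ (-η) * Real.exp (-Real.log T * |α|)) * (2 * B) :=
            mul_le_mul hKle h2B (norm_nonneg _) (by positivity)
        _ = 2 * B * (Real.log T * T ^ (-η)) * Real.exp (-Real.log T * |α|) := by ring
        _ ≤ G α := le_add_of_nonneg_left (by positivity)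
  calc ‖∫ α, ((K α : ℝ) : ℂ) * (θ α - θ 0)‖ ≤ ∫ α, G α :=
        norm_integral_le_of_norm_le hGi (Eventually.of_forall hbound)
    _ = ε / 2 + 4 * B * T ^ (-η) := hGint
    _ < ε := by linarith

/-! ## Integrating Montgomery's theorem against a test function -/

/-- `F(α, T)` is continuous in `α` (a finite sum of cosines). [cite: Montgomery1973, §1 (1)] -/
theorem continuous_montgomeryFormFactor (T : ℝ) : Continuous fun α : ℝ ↦ montgomeryFormFactor α T := by
  unfold montgomeryFormFactor
  fun_prop

/-- A function vanishing off `{|α| ≤ r}` has compact support. [folklore] -/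
theorem hasCompactSupport_of_eq_zero {θ : ℝ → ℂ} {r : ℝ} (h : ∀ α, r < |α| → θ α = 0) :
    HasCompactSupport θ := by
  refine HasCompactSupport.intro (isCompact_closedBall (0 : ℝ) r) fun α hα ↦ h α ?_
  rw [Metric.mem_closedBall, dist_zero_right, Real.norm_eq_abs, not_le] at hα
  exact hα

/-- **Montgomery's theorem, integrated.** If at height `T > 1` the form factor satisfies
Montgomery's uniform estimate `|F(α, T) − (T^{−2|α|} log T + |α|)| ≤ ε T^{−2|α|} log T + ε` on
`|α| ≤ 1 − δ`, then for every continuous `θ` vanishing on `|α| > 1 − δ` and bounded by `B`,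
`‖∫ F θ − (∫ log T · T^{−2|α|} θ + ∫ |α| θ)‖ ≤ ε (B + ∫ ‖θ‖)` (the kernel has mass one).
[cite: Montgomery1973, §1 Theorem] -/
theorem norm_integral_formFactor_sub_le {T δ ε : ℝ} (hT : 1 < T) (hε : 0 ≤ ε)
    (hM : ∀ α : ℝ, |α| ≤ 1 - δ →
      |montgomeryFormFactor α T - (T ^ (-2 * |α|) * Real.log T + |α|)| ≤
        ε * (T ^ (-2 * |α|) * Real.log T) + ε)
    {θ : ℝ → ℂ} (hθ : Continuous θ) (hθ0 : ∀ α, 1 - δ < |α| → θ α = 0)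
    {B : ℝ} (hθB : ∀ α, ‖θ α‖ ≤ B) :
    ‖(∫ α, (montgomeryFormFactor α T : ℂ) * θ α) -
        ((∫ α, ((Real.log T * T ^ (-2 * |α|) : ℝ) : ℂ) * θ α) + ∫ α, ((|α| : ℝ) : ℂ) * θ α)‖ ≤
      ε * (B + ∫ α, ‖θ α‖) := by
  have hT0 : 0 < T := one_pos.trans hT
  have hL : 0 < Real.log T := Real.log_pos hT
  have hB0 : 0 ≤ B := (norm_nonneg _).trans (hθB 0)
  have hsupp : HasCompactSupport θ := hasCompactSupport_of_eq_zero hθ0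
  -- integrability of the three integrands (continuous with compact support)
  have hiF : Integrable fun α : ℝ ↦ (montgomeryFormFactor α T : ℂ) * θ α :=
    ((continuous_ofReal.comp (continuous_montgomeryFormFactor T)).mul hθ).integrable_of_hasCompactSupport
      hsupp.mul_left
  have hiK : Integrable fun α : ℝ ↦ ((Real.log T * T ^ (-2 * |α|) : ℝ) : ℂ) * θ α :=
    (integrable_log_mul_rpow hT).ofReal.mul_bdd hθ.aestronglyMeasurable (Eventually.of_forall hθB)
  have hiA : Integrable fun α : ℝ ↦ ((|α| : ℝ) : ℂ) * θ α :=
    ((continuous_ofReal.comp continuous_abs).mul hθ).integrable_of_hasCompactSupport hsupp.mul_left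
  have hiθ : Integrable θ := hθ.integrable_of_hasCompactSupport hsupp
  -- combine into one integral
  have hcomb : (∫ α, (montgomeryFormFactor α T : ℂ) * θ α) -
      ((∫ α, ((Real.log T * T ^ (-2 * |α|) : ℝ) : ℂ) * θ α) + ∫ α, ((|α| : ℝ) : ℂ) * θ α) =
      ∫ α, ((montgomeryFormFactor α T - (T ^ (-2 * |α|) * Real.log T + |α|) : ℝ) : ℂ) * θ α := by
    have hiKA : Integrable fun α : ℝ ↦ ((Real.log T * T ^ (-2 * |α|) : ℝ) : ℂ) * θ α +
        ((|α| : ℝ) : ℂ) * θ α := hiK.add hiA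
    rw [← integral_add hiK hiA, ← integral_sub hiF hiKA]
    refine integral_congr_ae (Eventually.of_forall fun α ↦ ?_)
    push_cast
    ring
  rw [hcomb]
  -- pointwise bound by an integrable function
  set G : ℝ → ℝ := fun α ↦ ε * B * (Real.log T * T ^ (-2 * |α|)) + ε * ‖θ α‖ with hG
  have hGi : Integrable G := ((integrable_log_mul_rpow hT).const_mul _).add (hiθ.norm.const_mul _)
  have hGint : ∫ α, G α = ε * (B + ∫ α, ‖θ α‖) := by
    have i1 : ∫ α : ℝ, ε * B * (Real.log T * T ^ (-2 * |α|)) = ε * B := by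
      rw [integral_const_mul, integral_log_mul_rpow hT, mul_one]
    have i2 : ∫ α : ℝ, ε * ‖θ α‖ = ε * ∫ α, ‖θ α‖ := integral_const_mul _ _
    rw [hG, integral_add ((integrable_log_mul_rpow hT).const_mul _) (hiθ.norm.const_mul _), i1, i2]
    ring
  have hbound : ∀ α, ‖((montgomeryFormFactor α T - (T ^ (-2 * |α|) * Real.log T + |α|) : ℝ) : ℂ) *
      θ α‖ ≤ G α := by
    intro α
    have hG0 : 0 ≤ G α := by positivity
    rcases le_or_gt |α| (1 - δ) with hα | hα
    · rw [norm_mul, Complex.norm_real, Real.norm_eq_abs]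
      calc |montgomeryFormFactor α T - (T ^ (-2 * |α|) * Real.log T + |α|)| * ‖θ α‖
          ≤ (ε * (T ^ (-2 * |α|) * Real.log T) + ε) * ‖θ α‖ :=
            mul_le_mul_of_nonneg_right (hM α hα) (norm_nonneg _)
        _ = ε * (Real.log T * T ^ (-2 * |α|)) * ‖θ α‖ + ε * ‖θ α‖ := by ring
        _ ≤ ε * (Real.log T * T ^ (-2 * |α|)) * B + ε * ‖θ α‖ := by
            gcongr
            exact hθB α
        _ = G α := by simp only [hG]; ring
    · rw [hθ0 α hα, mul_zero, norm_zero]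
      exact hG0
  calc ‖∫ α, ((montgomeryFormFactor α T - (T ^ (-2 * |α|) * Real.log T + |α|) : ℝ) : ℂ) * θ α‖
      ≤ ∫ α, G α := norm_integral_le_of_norm_le hGi (Eventually.of_forall hbound)
    _ = ε * (B + ∫ α, ‖θ α‖) := hGint

/-- Uniform corollary: under the same estimate, `‖∫ F(α, T) θ(α) dα‖ ≤ (1 + ε)(B + ∫ ‖θ‖)` for
every continuous `θ` vanishing on `|α| > 1 − δ` (`0 ≤ δ`) and bounded by `B` — a bound that does
not see the phase of `θ`, used below with `θ(α) = ψ₀(α) e(sα)` uniformly in the shift `s`.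
[cite: Montgomery1973, §1 Theorem] -/
theorem norm_integral_formFactor_le {T δ ε : ℝ} (hT : 1 < T) (hε : 0 ≤ ε) (hδ : 0 ≤ δ)
    (hM : ∀ α : ℝ, |α| ≤ 1 - δ →
      |montgomeryFormFactor α T - (T ^ (-2 * |α|) * Real.log T + |α|)| ≤
        ε * (T ^ (-2 * |α|) * Real.log T) + ε)
    {θ : ℝ → ℂ} (hθ : Continuous θ) (hθ0 : ∀ α, 1 - δ < |α| → θ α = 0)
    {B : ℝ} (hθB : ∀ α, ‖θ α‖ ≤ B) :
    ‖∫ α, (montgomeryFormFactor α T : ℂ) * θ α‖ ≤ (1 + ε) * (B + ∫ α, ‖θ α‖) := by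
  have hB0 : 0 ≤ B := (norm_nonneg _).trans (hθB 0)
  have hsupp : HasCompactSupport θ := hasCompactSupport_of_eq_zero hθ0
  have hiθ : Integrable θ := hθ.integrable_of_hasCompactSupport hsupp
  have h1 := norm_integral_formFactor_sub_le hT hε hM hθ hθ0 hθB
  -- `‖∫ K θ‖ ≤ B`
  have hK : ‖∫ α, ((Real.log T * T ^ (-2 * |α|) : ℝ) : ℂ) * θ α‖ ≤ B := by
    have hb : ∀ α, ‖((Real.log T * T ^ (-2 * |α|) : ℝ) : ℂ) * θ α‖ ≤
        B * (Real.log T * T ^ (-2 * |α|)) := by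
      intro α
      have hK0 : 0 ≤ Real.log T * T ^ (-2 * |α|) := by
        have := Real.log_pos hT
        positivity
      rw [norm_mul, Complex.norm_real, Real.norm_of_nonneg hK0, mul_comm]
      exact mul_le_mul_of_nonneg_right (hθB α) hK0
    calc ‖∫ α, ((Real.log T * T ^ (-2 * |α|) : ℝ) : ℂ) * θ α‖
        ≤ ∫ α, B * (Real.log T * T ^ (-2 * |α|)) :=
          norm_integral_le_of_norm_le ((integrable_log_mul_rpow hT).const_mul _)
            (Eventually.of_forall hb)
      _ = B := by rw [integral_const_mul, integral_log_mul_rpow hT, mul_one]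
  -- `‖∫ |α| θ‖ ≤ ∫ ‖θ‖`
  have hA : ‖∫ α, ((|α| : ℝ) : ℂ) * θ α‖ ≤ ∫ α, ‖θ α‖ := by
    refine norm_integral_le_of_norm_le hiθ.norm (Eventually.of_forall fun α ↦ ?_)
    rw [norm_mul, Complex.norm_real, Real.norm_eq_abs, abs_abs]
    rcases le_or_gt |α| (1 - δ) with hα | hα
    · calc |α| * ‖θ α‖ ≤ 1 * ‖θ α‖ := by gcongr; linarith
        _ = ‖θ α‖ := one_mul _
    · simp [hθ0 α hα]
  have hI0 : 0 ≤ ∫ α, ‖θ α‖ := integral_nonneg fun α ↦ norm_nonneg _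
  calc ‖∫ α, (montgomeryFormFactor α T : ℂ) * θ α‖
      ≤ ‖(∫ α, (montgomeryFormFactor α T : ℂ) * θ α) -
          ((∫ α, ((Real.log T * T ^ (-2 * |α|) : ℝ) : ℂ) * θ α) + ∫ α, ((|α| : ℝ) : ℂ) * θ α)‖ +
        ‖(∫ α, ((Real.log T * T ^ (-2 * |α|) : ℝ) : ℂ) * θ α) + ∫ α, ((|α| : ℝ) : ℂ) * θ α‖ :=
        norm_le_norm_sub_add _ _
    _ ≤ ε * (B + ∫ α, ‖θ α‖) + (B + ∫ α, ‖θ α‖) := by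
        gcongr
        exact (norm_add_le _ _).trans (add_le_add hK hA)
    _ = (1 + ε) * (B + ∫ α, ‖θ α‖) := by ring

/-- **Montgomery's theorem against a test function** (Montgomery 1973, Theorem, in the
integrated form in which it is applied, cf. Goldston 2005, §5, (5.3)): assuming
RH, for every continuous `ψ` vanishing on `|α| > 1 − δ` (`δ > 0`),
`∫ F(α, T) ψ(α) dα → ψ(0) + ∫ |α| ψ(α) dα` as `T → ∞`. From the tree's
`montgomery_pair_correlation_restricted_holds` (uniform clause), the approximate identity
`tendsto_integral_log_mul_rpow_mul`, and `norm_integral_formFactor_sub_le`.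
[cite: Montgomery1973, §1 Theorem] -/
theorem tendsto_integral_formFactor_mul (hRH : RiemannHypothesis) {ψ : ℝ → ℂ}
    (hψ : Continuous ψ) {δ : ℝ} (hδ : 0 < δ) (hψ0 : ∀ α, 1 - δ < |α| → ψ α = 0) :
    Tendsto (fun T : ℝ ↦ ∫ α, (montgomeryFormFactor α T : ℂ) * ψ α) atTop
      (𝓝 (ψ 0 + ∫ α, ((|α| : ℝ) : ℂ) * ψ α)) := by
  have hsupp : HasCompactSupport ψ := hasCompactSupport_of_eq_zero hψ0
  obtain ⟨B, hB⟩ := hψ.bounded_above_of_compact_support hsupp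
  have hB0 : 0 ≤ B := (norm_nonneg _).trans (hB 0)
  set B₁ : ℝ := ∫ α, ‖ψ α‖ with hB₁
  have hB₁0 : 0 ≤ B₁ := integral_nonneg fun α ↦ norm_nonneg _
  -- the error part tends to `0`
  have herr : Tendsto (fun T : ℝ ↦ (∫ α, (montgomeryFormFactor α T : ℂ) * ψ α) -
      ((∫ α, ((Real.log T * T ^ (-2 * |α|) : ℝ) : ℂ) * ψ α) + ∫ α, ((|α| : ℝ) : ℂ) * ψ α))
      atTop (𝓝 0) := by
    refine Metric.tendsto_nhds.2 fun ε hε ↦ ?_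
    have hε' : 0 < ε / (2 * (B + B₁ + 1)) := by positivity
    filter_upwards [montgomery_pair_correlation_restricted_holds hRH hδ hε',
      eventually_gt_atTop (1 : ℝ)] with T hM hT
    rw [dist_zero_right]
    calc _ ≤ ε / (2 * (B + B₁ + 1)) * (B + B₁) :=
          norm_integral_formFactor_sub_le hT hε'.le hM hψ hψ0 hB
      _ < ε := by
          rw [div_mul_eq_mul_div, div_lt_iff₀ (by positivity)]
          nlinarith
  have hmain := (herr.add (tendsto_integral_log_mul_rpow_mul hψ hB)).add
    (tendsto_const_nhds (x := ∫ α, ((|α| : ℝ) : ℂ) * ψ α))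
  rw [zero_add] at hmain
  refine hmain.congr fun T ↦ ?_
  ring

/-! ## `N(T) ∼ (T/2π) log T` -/

/-- Riemann–von Mangoldt in ratio form: `N(T) / ((T/2π) log T) → 1`. [cite: Titchmarsh1986, Thm. 9.4] -/
theorem tendsto_zetaZeroCount_div_main :
    Tendsto (fun T : ℝ ↦ (zetaZeroCount T : ℝ) / (T / (2 * π) * Real.log T)) atTop (𝓝 1) := by
  have h := riemann_von_mangoldt_holds
  -- error term / main → 0
  have h1 : Tendsto (fun T : ℝ ↦ ((zetaZeroCount T : ℝ) -
      (T / (2 * π) * Real.log (T / (2 * π)) - T / (2 * π))) / (T / (2 * π) * Real.log T))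
      atTop (𝓝 0) := by
    refine (h.trans_isLittleO ?_).tendsto_div_nhds_zero
    -- `log T = o(T/(2π) log T)`
    have e : (fun T : ℝ ↦ Real.log T) =o[atTop] fun T ↦ T / (2 * π) * Real.log T := by
      refine Asymptotics.isLittleO_of_tendsto' ?_ ?_
      · filter_upwards [eventually_gt_atTop (1 : ℝ)] with T hT h0
        have hL : 0 < Real.log T := Real.log_pos hT
        have : T / (2 * π) * Real.log T ≠ 0 := by positivity
        exact absurd h0 this
      · have : Tendsto (fun T : ℝ ↦ (2 * π) * T⁻¹) atTop (𝓝 ((2 * π) * 0)) :=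
          tendsto_inv_atTop_zero.const_mul _
        rw [mul_zero] at this
        refine this.congr' ?_
        filter_upwards [eventually_gt_atTop (1 : ℝ)] with T hT
        have hL : Real.log T ≠ 0 := (Real.log_pos hT).ne'
        field_simp
    exact e
  -- main(T/(2π)) / main → 1
  have h2 : Tendsto (fun T : ℝ ↦ (T / (2 * π) * Real.log (T / (2 * π)) - T / (2 * π)) /
      (T / (2 * π) * Real.log T)) atTop (𝓝 1) := by
    have e : ∀ᶠ T : ℝ in atTop, (T / (2 * π) * Real.log (T / (2 * π)) - T / (2 * π)) /
        (T / (2 * π) * Real.log T) = 1 - (Real.log (2 * π) + 1) * (Real.log T)⁻¹ := by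
      filter_upwards [eventually_gt_atTop (1 : ℝ)] with T hT
      have hL : Real.log T ≠ 0 := (Real.log_pos hT).ne'
      have hT0 : T ≠ 0 := by positivity
      rw [Real.log_div hT0 (by positivity)]
      field_simp
      ring
    have hlim : Tendsto (fun T : ℝ ↦ 1 - (Real.log (2 * π) + 1) * (Real.log T)⁻¹) atTop
        (𝓝 (1 - (Real.log (2 * π) + 1) * 0)) :=
      tendsto_const_nhds.sub ((tendsto_inv_atTop_zero.comp Real.tendsto_log_atTop).const_mul _)
    rw [mul_zero, sub_zero] at hlim
    exact hlim.congr' (EventuallyEq.symm e)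
  have h3 := h1.add h2
  rw [zero_add] at h3
  refine h3.congr' ?_
  filter_upwards [eventually_gt_atTop (1 : ℝ)] with T hT
  have hL : Real.log T ≠ 0 := (Real.log_pos hT).ne'
  have hT0 : T ≠ 0 := by positivity
  field_simp
  ring

/-- **Smoothed, weighted pair correlation sums in the limit** (RS Theorem 3.1/3.2 at level
`n = 2` in Montgomery's form): assuming RH, for continuous `ψ` vanishing on `|α| > 1 − δ`
(`δ > 0`) with Fourier transform `ψ̂ = 𝓕 ψ`,
`(1/N(T)) ∑_{0 < γ, γ' ≤ T} w(γ − γ') ψ̂(L(γ − γ')/2π) → ψ(0) + ∫ |α| ψ(α) dα`, `L = log T`.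
[cite: Goldston2005, §5 (5.3)] -/
theorem tendsto_sum_pairs_weight_fourier_div (hRH : RiemannHypothesis) {ψ : ℝ → ℂ}
    (hψ : Continuous ψ) {δ : ℝ} (hδ : 0 < δ) (hψ0 : ∀ α, 1 - δ < |α| → ψ α = 0) :
    Tendsto (fun T : ℝ ↦ (∑ p ∈ zeroIndexSet T ×ˢ zeroIndexSet T,
        (montgomeryWeight (zetaOrdinate p.1 - zetaOrdinate p.2) : ℂ) *
          𝓕 ψ (Real.log T / (2 * π) * (zetaOrdinate p.1 - zetaOrdinate p.2))) / zetaZeroCount T)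
      atTop (𝓝 (ψ 0 + ∫ α, ((|α| : ℝ) : ℂ) * ψ α)) := by
  have hsupp : HasCompactSupport ψ := hasCompactSupport_of_eq_zero hψ0
  have hI := tendsto_integral_formFactor_mul hRH hψ hδ hψ0
  -- `(T L/2π)/N(T) → 1`
  have hN : Tendsto (fun T : ℝ ↦ (((T * Real.log T / (2 * π)) / zetaZeroCount T : ℝ) : ℂ)) atTop
      (𝓝 1) := by
    have h := tendsto_zetaZeroCount_div_main.inv₀ one_ne_zero
    rw [inv_one] at h
    have h' : Tendsto (fun T : ℝ ↦ (T * Real.log T / (2 * π)) / zetaZeroCount T) atTop (𝓝 1) := by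
      refine h.congr' ?_
      filter_upwards [eventually_gt_atTop (1 : ℝ)] with T hT
      rw [inv_div]
      ring
    rw [← ofReal_one]
    exact (continuous_ofReal.tendsto 1).comp h'
  have hprod := hN.mul hI
  rw [one_mul] at hprod
  refine hprod.congr' ?_
  filter_upwards [eventually_gt_atTop (1 : ℝ)] with T hT
  rw [sum_pairs_fourier_eq_integral_formFactor ψ hψ hsupp hT]
  push_cast
  ring

end RudnickSarnak

end Literature.NumberTheory.LFunctions

end
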